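import Literature.AlgebraicGeometry.Resolution.PrincipalizationToResolution
import Mathlib.Topology.NoetherianSpace

/-!
# Irreducible components of a locally integral Noetherian scheme are clopen

Crux `ProductDescent` (stmt-ResolutionOfSingularities-15231), line `birth`, stub
`stub_componentsClopen`.

If the underlying space of a scheme `X` is Noetherian and every local ring `𝒪_{X,x}` is a domain,
then every irreducible component `C` of `X` is open and closed:

* two irreducible components through a point `x` coincide, because the image of the generic point
  of `Spec 𝒪_{X,x}` (a domain, so irreducible) generalises the generic point of every component
  through `x` (in tree: `eq_of_mem_irreducibleComponents_of_isDomain_stalk`, Stacks Tag 0357);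
* hence the complement of `C` is the union of the finitely many
  (`TopologicalSpace.NoetherianSpace.finite_irreducibleComponents`) other components, each closed,
  so `C` is open; it is closed as any irreducible component is.

All statements are folklore; no named fact is introduced.
-/

noncomputable section

set_option linter.dupNamespace false

open CategoryTheory CategoryTheory.Limits AlgebraicGeometry Literature.AlgebraicGeometry.Resolution

namespace Summit.ResolutionOfSingularities.ResolutionOfSingularities.Theorems.ProductDescent.Birth

/-- In a space with finitely many irreducible components, an irreducible component `C` whose
points lie on no other irreducible component is clopen: its complement is the finite union of the
other (closed) components. [folklore] -/
theorem componentsClopen_isClopen_of_forall_eq {α : Type*} [TopologicalSpace α]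
    (hfin : (irreducibleComponents α).Finite) {C : Set α} (hC : C ∈ irreducibleComponents α)
    (huniq : ∀ D ∈ irreducibleComponents α, ∀ x ∈ C, x ∈ D → D = C) : IsClopen C := by
  refine ⟨isClosed_of_mem_irreducibleComponents C hC, ?_⟩
  have hc : Cᶜ = ⋃ D ∈ {D ∈ irreducibleComponents α | D ≠ C}, D := by
    ext x
    simp only [Set.mem_compl_iff, Set.mem_iUnion, Set.mem_setOf_eq, exists_prop]
    constructor
    · intro hx
      exact ⟨irreducibleComponent x, ⟨irreducibleComponent_mem_irreducibleComponents x,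
        fun h => hx (h ▸ mem_irreducibleComponent)⟩, mem_irreducibleComponent⟩
    · rintro ⟨D, ⟨hD, hDC⟩, hxD⟩ hxC
      exact hDC (huniq D hD x hxC hxD)
  rw [← isClosed_compl_iff, hc]
  exact (hfin.subset fun D hD => hD.1).isClosed_biUnion
    fun D hD => isClosed_of_mem_irreducibleComponents D hD.1

/-- **Components of a locally integral Noetherian scheme are clopen.** If the underlying space of
the scheme `X` is Noetherian and every local ring of `X` is a domain, then every irreducible
component of `X` is open and closed (two components through `x` would give two minimal primes of
the domain `𝒪_{X,x}`; the finitely many other components are closed). [folklore] -/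
theorem stub_componentsClopen :
    ∀ (X : Scheme.{0}), TopologicalSpace.NoetherianSpace X →
      (∀ x : X, IsDomain (X.presheaf.stalk x)) →
      ∀ C ∈ irreducibleComponents (X : Type), IsClopen C := by
  intro X hX hdom C hC
  refine componentsClopen_isClopen_of_forall_eq
    (TopologicalSpace.NoetherianSpace.finite_irreducibleComponents (α := X)) hC
    fun D hD x hxC hxD => ?_
  haveI := hdom x
  exact eq_of_mem_irreducibleComponents_of_isDomain_stalk x hD hC hxD hxC

end Summit.ResolutionOfSingularities.ResolutionOfSingularities.Theorems.ProductDescent.Birth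

end
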